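import Literature.Combinatorics.Sahi2008.Chains
import Summits.CriticalPhenomena.PercolationContinuityZ3.Theorems.PercNearOneGluingNoHeavyLowerTailSahiSlotPatternSignMinus
import Summits.CriticalPhenomena.PercolationContinuityZ3.Theorems.PercNearOneGluingNoHeavyLowerTailSahiSlotPatternSymm

/-!
# The pattern-level BRANCHING RULE, and the reduction of every cell to ANTICHAINS: a family with a comparable pair is positive

Support file (lane `prim-masterthm-p3`, generation 18; `--supports stmt-CriticalPhenomena-4575`).  Pure proofs, no definitions,
no `sorry`, standard axioms.

1. **BRANCHING RULE** (`patternForm_one_cons_eq`).  Sahi's identity `E_{n+2}(1, g) = n · E_{n+1}(g)` (tree: `sahiE_cons_of_absorbing`, every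
   weight) lifts to the pattern functional through the extraction principle (`sum_perm_eq_of_forall_gridW`), the fibration
   (`sum_perm_comp_eq`) and the rectangular-to-square reduction (`sum_inj_diagForm_eq_sum_mono_patternForm`):
   `patternForm d (n+2) (1, G) = n · Σ_{v monotone skeletons} patternForm d (n+1) (G ∘ slot_v)`;
   hence `SlotPatternPos d (n+1) ⟹ patternForm d (n+2) (1, 1_U) ≥ 0` for up-sets `U` (`patternForm_one_cons_nonneg`).
2. **THE TOP-CONTAINING STRATUM** (`patternForm_cons_nonneg_of_forall_exists`).  If the head up-set `U_0` contains `∩_{j≥1} U_j`, then by the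
   profile decomposition (`patternForm_cons_eq_sum_profile`) and the SIGN⁻ law (`patternForm_single_nonpos`)
   `patternForm(1_{U_0}, 1_U) = Σ_y P_y − Σ_{y ∉ U_0} P_y ≥ patternForm(1, 1_U) ≥ 0`, given the lower cells `SlotPatternPos d k`, `k ≤ n+1`.
3. **COMPARABLE PAIR ⟹ POSITIVE** (`patternForm_setInd_nonneg_of_comparable`): if `U_i ⊆ U_j` for some `i ≠ j` then `U_j ⊇ U_i ⊇ ∩_{k≠j} U_k`, so
   (after moving `j` to the head by `patternForm_perm_slots`) stratum 2 applies.  CONSEQUENTLY EVERY CELL REDUCES TO ANTICHAINS: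
   `SlotPatternPos d (n+2)` given the lower cells ⟺ positivity on families of PAIRWISE INCOMPARABLE up-sets
   (`slotPatternPos_of_antichains`).  At the first open cell `(3,4)` the lower cells are theorems, so Lieb–Sahi's `(3,4)` holds for every
   quadruple of up-sets of `[4]^3` with a comparable pair (companion computational corollary in `…SignMinusThreeFour`-style file
   `…SahiSlotPatternBranchingThreeFour`). [this work]
-/

namespace Summit.CriticalPhenomena.PercolationContinuityZ3.Theorems

open Finset Function Equiv Equiv.Perm
open Literature.Combinatorics.Sahi2008 Literature.Combinatorics.Sahi2008.CycleForm

namespace SahiSlot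

section Branching

open scoped Classical

variable {d n : ℕ}

/-- Marginalising the head slot of a slot family under a product of axis probability weights:
`Σ_r (Π_{a,j} g_a(r_a j)) · Ψ(r ∘ succ) = Σ_{r'} (Π g) · Ψ(r')`. [this work] -/
theorem sum_slotW_comp_succ {m : ℕ} {Y : Type*} [Fintype Y] (g : Fin d → Y → ℝ) (hg : ∀ a, ∑ y, g a y = 1)
    (Ψ : (Fin d → Fin m → Y) → ℝ) :
    ∑ r : Fin d → Fin (m + 1) → Y, slotW g r * Ψ (fun a j => r a j.succ) = ∑ r' : Fin d → Fin m → Y, slotW g r' * Ψ r' := by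
  -- split `r ↦ (r•0, r∘succ)`
  let e : (Fin d → Fin (m + 1) → Y) ≃ (Fin d → Y) × (Fin d → Fin m → Y) :=
    { toFun := fun r => (fun a => r a 0, fun a j => r a j.succ)
      invFun := fun x => fun a => Fin.cons (x.1 a) (x.2 a)
      left_inv := fun r => by funext a j; refine Fin.cases ?_ (fun i => ?_) j <;> simp
      right_inv := fun x => by ext a <;> simp }
  rw [← e.symm.sum_comp, Fintype.sum_prod_type]
  have hw : ∀ (x : Fin d → Y) (r' : Fin d → Fin m → Y),
      slotW g (e.symm (x, r')) = (∏ a, g a (x a)) * slotW g r' := by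
    intro x r'
    unfold slotW
    rw [← prod_mul_distrib]
    refine prod_congr rfl fun a _ => ?_
    rw [Fin.prod_univ_succ]
    rfl
  have hΨ : ∀ (x : Fin d → Y) (r' : Fin d → Fin m → Y), (fun a j => (e.symm (x, r')) a j.succ) = r' := by
    intro x r'
    funext a j
    show (Fin.cons (x a) (r' a) : Fin (m + 1) → Y) j.succ = r' a j
    rw [Fin.cons_succ]
  simp_rw [hw, hΨ, mul_assoc, ← mul_sum]
  rw [← sum_mul, ← Fintype.prod_sum (fun a y => g a y)]
  simp [hg]

/-- **THE PATTERN-LEVEL BRANCHING RULE**: `patternForm d (n+2) (1, G) = n · Σ_{v monotone} patternForm d (n+1) (G ∘ slot_v)`. [this work] -/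
theorem patternForm_one_cons_eq (G : Fin (n + 1) → Q d (n + 2) → ℝ) :
    patternForm d (n + 2) (Fin.cons (fun _ => (1 : ℝ)) G) =
      (n : ℝ) * ∑ v ∈ univ.filter (fun v : Fin d → Fin (n + 1) → Fin (n + 2) => ∀ a, StrictMono (v a)),
        patternForm d (n + 1) (fun i => G i ∘ slotMap v) := by
  -- the two kernels
  have key := sum_perm_eq_of_forall_gridW (d := d) (n := n + 2) (by omega)
    (fun r => diagForm d (n + 2) (fun i => (Fin.cons (fun _ => (1 : ℝ)) G : Fin (n + 2) → Q d (n + 2) → ℝ) i ∘ slotMap r))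
    (fun r => (n : ℝ) * diagForm d (n + 1) (fun i => G i ∘ slotMap (fun a j => r a j.succ)))
    (fun g hg => by
      rw [← sahiE_gridW_eq_sum_diagForm g hg (by omega)]
      -- Sahi's branching identity for the grid weight (`Matrix.vecCons = Fin.cons` definitionally)
      have hbr := sahiE_cons_of_absorbing (gridW g) n (fun _ => (1 : ℝ)) G (fun i => by funext x; simp)
      have hex : ex (gridW g) (fun _ : Q d (n + 2) => (1 : ℝ)) = 1 := by
        rw [ex_def]; simp_rw [mul_one]; exact sum_gridW g hg
      rw [hex, show ((n : ℝ) + 1 - 1) = n by ring] at hbr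
      rw [show sahiE (gridW g) (n + 2) (fun i => (Fin.cons (fun _ => (1 : ℝ)) G : Fin (n + 2) → Q d (n + 2) → ℝ) i) =
          sahiE (gridW g) (n + 2) (Matrix.vecCons (fun _ => (1 : ℝ)) G) from rfl, hbr]
      -- the right kernel marginalises the head slot
      simp_rw [← mul_assoc, mul_comm (slotW g _) (n : ℝ), mul_assoc]
      rw [← mul_sum, sum_slotW_comp_succ g hg (fun u => diagForm d (n + 1) (fun i => G i ∘ slotMap u)),
        ← sahiE_gridW_eq_sum_diagForm g hg (by omega)])
  -- left: `patternForm`; right: fibration over the tail slots, then rectangular = Σ square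
  have hL : ∑ τ : Fin d → Perm (Fin (n + 2)),
      diagForm d (n + 2) (fun i => (Fin.cons (fun _ => (1 : ℝ)) G : Fin (n + 2) → Q d (n + 2) → ℝ) i ∘ slotMap fun a => ⇑(τ a)) =
      patternForm d (n + 2) (Fin.cons (fun _ => (1 : ℝ)) G) := rfl
  rw [← hL, key, ← mul_sum]
  congr 1
  have hfib := sum_perm_comp_eq (d := d) (k := n + 1) (N := n + 2) (ι := Fin.succ) (Fin.succ_injective _)
    (fun u => diagForm d (n + 1) (fun i => G i ∘ slotMap u))
  have h1 : n + 2 - (n + 1) = 1 := by omega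
  rw [h1, Nat.factorial_one, Nat.cast_one, one_pow, one_mul] at hfib
  rw [show (∑ τ : Fin d → Perm (Fin (n + 2)), diagForm d (n + 1) (fun i => G i ∘ slotMap fun a j => (τ a) j.succ)) =
      ∑ τ : Fin d → Perm (Fin (n + 2)), diagForm d (n + 1) (fun i => G i ∘ slotMap fun a => ⇑(τ a) ∘ Fin.succ) from rfl,
    hfib, sum_inj_diagForm_eq_sum_mono_patternForm]

/-- **Branching positivity**: `SlotPatternPos d (n+1) ⟹ patternForm d (n+2) (1, 1_{U_1},…,1_{U_{n+1}}) ≥ 0` for up-sets `U_j`. [this work] -/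
theorem patternForm_one_cons_nonneg (hP : SlotPatternPos d (n + 1)) (U : Fin (n + 1) → Finset (Q d (n + 2)))
    (hU : ∀ j, IsUpperSet (U j : Set (Q d (n + 2)))) :
    0 ≤ patternForm d (n + 2) (Fin.cons (fun _ => (1 : ℝ)) (fun j => setInd (U j))) := by
  rw [patternForm_one_cons_eq]
  refine mul_nonneg (Nat.cast_nonneg _) (sum_nonneg fun v hv => ?_)
  rw [mem_filter] at hv
  have hmono : ∀ a, Monotone (v a) := fun a => (hv.2 a).monotone
  simp_rw [setInd_comp_slotMap]
  exact hP _ fun i => isUpperSet_pullSet hmono (hU i)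

/-- **THE TOP-CONTAINING STRATUM**: if the head up-set `U_0` contains `∩_j U_j` (i.e. every point outside `U_0` is outside some `U_j`),
then `patternForm d (n+2) (1_{U_0}, 1_{U_1}, …, 1_{U_{n+1}}) ≥ 0`, given the lower cells `SlotPatternPos d k`, `1 ≤ k ≤ n+1`. [this work] -/
theorem patternForm_cons_nonneg_of_forall_exists (hP : ∀ k, 1 ≤ k → k ≤ n + 1 → SlotPatternPos d k)
    (U₀ : Finset (Q d (n + 2))) (U : Fin (n + 1) → Finset (Q d (n + 2))) (hU : ∀ j, IsUpperSet (U j : Set (Q d (n + 2))))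
    (hsup : ∀ y, y ∉ U₀ → ∃ j, y ∉ U j) :
    0 ≤ patternForm d (n + 2) (Fin.cons (setInd U₀) (fun j => setInd (U j))) := by
  rw [patternForm_cons_eq_sum_profile]
  have hone := patternForm_one_cons_nonneg (hP (n + 1) (by omega) le_rfl) U hU
  rw [patternForm_cons_eq_sum_profile] at hone
  simp only [one_mul] at hone
  -- `Σ_y 1_{U₀}(y) P_y = Σ_y P_y - Σ_{y ∉ U₀} P_y ≥ Σ_y P_y ≥ 0`
  have hsplit : ∑ y : Q d (n + 2), setInd U₀ y * patternForm d (n + 2) (Fin.cons (setInd {y}) (fun j => setInd (U j))) =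
      (∑ y : Q d (n + 2), patternForm d (n + 2) (Fin.cons (setInd {y}) (fun j => setInd (U j)))) -
        ∑ y ∈ univ.filter (fun y => y ∉ U₀), patternForm d (n + 2) (Fin.cons (setInd {y}) (fun j => setInd (U j))) := by
    rw [sum_filter, ← sum_sub_distrib]
    refine sum_congr rfl fun y _ => ?_
    simp only [setInd_apply]
    split_ifs <;> simp_all
  rw [hsplit]
  have hneg : ∑ y ∈ univ.filter (fun y => y ∉ U₀), patternForm d (n + 2) (Fin.cons (setInd {y}) (fun j => setInd (U j))) ≤ 0 := by
    refine sum_nonpos fun y hy => ?_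
    rw [mem_filter] at hy
    obtain ⟨j₀, hj₀⟩ := hsup y hy.2
    exact patternForm_single_nonpos hP y U hU j₀ hj₀
  linarith

/-- **COMPARABLE PAIR ⟹ POSITIVE** (every `d`, order `n+2`, given the lower cells): if `W_i ⊆ W_j` for some `i ≠ j` in a family of up-sets
of `[n+2]^d`, then `patternForm d (n+2) (1_W) ≥ 0`. [this work] -/
theorem patternForm_setInd_nonneg_of_comparable (hP : ∀ k, 1 ≤ k → k ≤ n + 1 → SlotPatternPos d k)
    (W : Fin (n + 2) → Finset (Q d (n + 2))) (hW : ∀ j, IsUpperSet (W j : Set (Q d (n + 2)))) {i j : Fin (n + 2)} (hij : i ≠ j)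
    (hWij : W i ⊆ W j) : 0 ≤ patternForm d (n + 2) (fun k => setInd (W k)) := by
  -- move `j` to the head
  rw [← patternForm_perm_slots (fun k => setInd (W k)) (Equiv.swap 0 j)]
  have hfam : (fun k => setInd (W (Equiv.swap 0 j k))) =
      Fin.cons (setInd (W j)) (fun l : Fin (n + 1) => setInd (W (Equiv.swap 0 j l.succ))) := by
    funext k
    refine Fin.cases ?_ (fun l => ?_) k
    · simp only [swap_apply_left, Fin.cons_zero]
    · simp only [Fin.cons_succ]
  rw [hfam]
  refine patternForm_cons_nonneg_of_forall_exists hP (W j) _ (fun l => hW _) fun y hy => ?_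
  -- `y ∉ W j ⊇ W i`, and `i = swap 0 j (l.succ)` for the tail index `l` with `l.succ = swap 0 j i`
  have hi0 : Equiv.swap 0 j i ≠ 0 := by
    intro h
    have h2 := congrArg (Equiv.swap (0 : Fin (n + 2)) j) h
    rw [swap_apply_self, swap_apply_left] at h2
    exact hij h2
  obtain ⟨l, hl⟩ := Fin.exists_succ_eq.2 hi0
  refine ⟨l, fun hmem => hy (hWij ?_)⟩
  rwa [hl, swap_apply_self] at hmem

/-- **SOME MEMBER CONTAINS THE INTERSECTION OF THE OTHERS ⟹ POSITIVE** (every `d`, order `n+2`, given the lower cells): if for some `j`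
every point lying in all `W_k`, `k ≠ j`, lies in `W_j`, then `patternForm d (n+2) (1_W) ≥ 0`. [this work] -/
theorem patternForm_setInd_nonneg_of_inter_subset (hP : ∀ k, 1 ≤ k → k ≤ n + 1 → SlotPatternPos d k)
    (W : Fin (n + 2) → Finset (Q d (n + 2))) (hW : ∀ j, IsUpperSet (W j : Set (Q d (n + 2)))) (j : Fin (n + 2))
    (hj : ∀ y, (∀ k, k ≠ j → y ∈ W k) → y ∈ W j) : 0 ≤ patternForm d (n + 2) (fun k => setInd (W k)) := by
  rw [← patternForm_perm_slots (fun k => setInd (W k)) (Equiv.swap 0 j)]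
  have hfam : (fun k => setInd (W (Equiv.swap 0 j k))) =
      Fin.cons (setInd (W j)) (fun l : Fin (n + 1) => setInd (W (Equiv.swap 0 j l.succ))) := by
    funext k
    refine Fin.cases ?_ (fun l => ?_) k
    · simp only [swap_apply_left, Fin.cons_zero]
    · simp only [Fin.cons_succ]
  rw [hfam]
  refine patternForm_cons_nonneg_of_forall_exists hP (W j) _ (fun l => hW _) fun y hy => ?_
  by_contra hcon
  push Not at hcon
  refine hy (hj y fun k hk => ?_)
  have hk0 : Equiv.swap 0 j k ≠ 0 := by
    intro h
    have h2 := congrArg (Equiv.swap (0 : Fin (n + 2)) j) h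
    rw [swap_apply_self, swap_apply_left] at h2
    exact hk h2
  obtain ⟨l, hl⟩ := Fin.exists_succ_eq.2 hk0
  have := hcon l
  rwa [hl, swap_apply_self] at this

/-- **EVERY CELL REDUCES TO ANTICHAINS**: given the lower cells, `SlotPatternPos d (n+2)` follows from positivity on families of PAIRWISE
INCOMPARABLE up-sets. [this work] -/
theorem slotPatternPos_of_antichains (hP : ∀ k, 1 ≤ k → k ≤ n + 1 → SlotPatternPos d k)
    (hanti : ∀ W : Fin (n + 2) → Finset (Q d (n + 2)), (∀ j, IsUpperSet (W j : Set (Q d (n + 2)))) →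
      (∀ i j, i ≠ j → ¬ W i ⊆ W j) → 0 ≤ patternForm d (n + 2) (fun k => setInd (W k))) :
    SlotPatternPos d (n + 2) := by
  intro W hW
  by_cases h : ∃ i j, i ≠ j ∧ W i ⊆ W j
  · obtain ⟨i, j, hij, hWij⟩ := h
    exact patternForm_setInd_nonneg_of_comparable hP W hW hij hWij
  · push Not at h
    exact hanti W hW fun i j hij => h i j hij

/-- The profile decomposition of an inserted point: `patternForm(1_{U₀ ∪ {y}}, F) = patternForm(1_{U₀}, F) + P_y(F)` for `y ∉ U₀`. [this work] -/
theorem patternForm_cons_insert_eq (U₀ : Finset (Q d (n + 2))) (F : Fin (n + 1) → Q d (n + 2) → ℝ) {y : Q d (n + 2)} (hy : y ∉ U₀) :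
    patternForm d (n + 2) (Fin.cons (setInd (insert y U₀)) F) =
      patternForm d (n + 2) (Fin.cons (setInd U₀) F) + patternForm d (n + 2) (Fin.cons (setInd {y}) F) := by
  rw [patternForm_cons_eq_sum_profile, patternForm_cons_eq_sum_profile (setInd U₀),
    patternForm_cons_eq_sum_profile (setInd {y}), ← sum_add_distrib]
  refine sum_congr rfl fun z _ => ?_
  rw [← add_mul]
  congr 1
  simp only [setInd_apply, mem_insert, mem_singleton]
  by_cases hz : z = y
  · subst hz; simp [hy]
  · simp [hz]

/-- **Monotone on the meet** (every order, unconditional): adding to the head a point lying in all tail members does not decrease the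
pattern functional (SIGN⁺). The all-order form of `prim-sahi`'s order-3 meet monotonicity. [this work] -/
theorem patternForm_cons_le_insert_of_mem (U₀ : Finset (Q d (n + 2))) (U : Fin (n + 1) → Finset (Q d (n + 2))) {y : Q d (n + 2)}
    (hy : y ∉ U₀) (hmem : ∀ j, y ∈ U j) :
    patternForm d (n + 2) (Fin.cons (setInd U₀) (fun j => setInd (U j))) ≤
      patternForm d (n + 2) (Fin.cons (setInd (insert y U₀)) (fun j => setInd (U j))) := by
  rw [patternForm_cons_insert_eq U₀ _ hy]
  have := patternForm_single_nonneg y U hmem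
  linarith

/-- **Antitone off the meet** (every order, given the lower cells): adding to the head a point outside some tail up-set does not increase
the pattern functional (SIGN⁻). The all-order form of `prim-sahi`'s `sStarD_anti_off_meet`. [this work] -/
theorem patternForm_cons_insert_le_of_not_mem (hP : ∀ k, 1 ≤ k → k ≤ n + 1 → SlotPatternPos d k) (U₀ : Finset (Q d (n + 2)))
    (U : Fin (n + 1) → Finset (Q d (n + 2))) (hU : ∀ j, IsUpperSet (U j : Set (Q d (n + 2)))) {y : Q d (n + 2)} (hy : y ∉ U₀)
    {j₀ : Fin (n + 1)} (hj : y ∉ U j₀) :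
    patternForm d (n + 2) (Fin.cons (setInd (insert y U₀)) (fun j => setInd (U j))) ≤
      patternForm d (n + 2) (Fin.cons (setInd U₀) (fun j => setInd (U j))) := by
  rw [patternForm_cons_insert_eq U₀ _ hy]
  have := patternForm_single_nonpos hP y U hU j₀ hj
  linarith

/-- **THE SHARP REDUCTION**: given the lower cells, `SlotPatternPos d (n+2)` follows from positivity on the families in which NO member
contains the intersection of the others (in particular pairwise incomparable). [this work] -/
theorem slotPatternPos_of_noncontaining (hP : ∀ k, 1 ≤ k → k ≤ n + 1 → SlotPatternPos d k)
    (hcore : ∀ W : Fin (n + 2) → Finset (Q d (n + 2)), (∀ j, IsUpperSet (W j : Set (Q d (n + 2)))) →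
      (∀ j, ∃ y, (∀ k, k ≠ j → y ∈ W k) ∧ y ∉ W j) → 0 ≤ patternForm d (n + 2) (fun k => setInd (W k))) :
    SlotPatternPos d (n + 2) := by
  intro W hW
  by_cases h : ∃ j, ∀ y, (∀ k, k ≠ j → y ∈ W k) → y ∈ W j
  · obtain ⟨j, hj⟩ := h
    exact patternForm_setInd_nonneg_of_inter_subset hP W hW j hj
  · push Not at h
    exact hcore W hW h

/-- **THE WHOLE SLOT TABLE REDUCES TO NON-CONTAINING FAMILIES**: if, for every dimension `d` and order `n+2`, positivity holds on the families of
up-sets of `[n+2]^d` in which no member contains the intersection of the others — the prover being allowed to assume all cells of lower order in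
the same dimension — then `SlotPatternPos d n` holds for all `d, n` (orders `0, 1` are theorems). [this work] -/
theorem forall_slotPatternPos_of_noncontaining
    (hcore : ∀ (d n : ℕ), (∀ k, 1 ≤ k → k ≤ n + 1 → SlotPatternPos d k) →
      ∀ W : Fin (n + 2) → Finset (Q d (n + 2)), (∀ j, IsUpperSet (W j : Set (Q d (n + 2)))) →
        (∀ j, ∃ y, (∀ k, k ≠ j → y ∈ W k) ∧ y ∉ W j) → 0 ≤ patternForm d (n + 2) (fun k => setInd (W k))) :
    ∀ d n, SlotPatternPos d n := by
  intro d n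
  induction n using Nat.strong_induction_on with
  | _ n ih =>
    match n, ih with
    | 0, _ => exact slotPatternPos_zero_right d
    | 1, _ => exact slotPatternPos_one d
    | m + 2, ih =>
      have hlow : ∀ k, 1 ≤ k → k ≤ m + 1 → SlotPatternPos d k := fun k _ hk => ih k (by omega)
      exact slotPatternPos_of_noncontaining hlow (hcore d m hlow)

/-- **Sahi's conjecture (every order, every FKG lattice) from the non-containing cores of the slot table.** [this work] -/
theorem forall_sahiConjecture_of_slot_noncontaining
    (hcore : ∀ (d n : ℕ), (∀ k, 1 ≤ k → k ≤ n + 1 → SlotPatternPos d k) →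
      ∀ W : Fin (n + 2) → Finset (Q d (n + 2)), (∀ j, IsUpperSet (W j : Set (Q d (n + 2)))) →
        (∀ j, ∃ y, (∀ k, k ≠ j → y ∈ W k) ∧ y ∉ W j) → 0 ≤ patternForm d (n + 2) (fun k => setInd (W k))) :
    ∀ n, SahiConjecture n :=
  fun n => sahiConjecture_of_forall_slotPatternPos fun d => forall_slotPatternPos_of_noncontaining hcore d n

/-- **The comb conjecture (M⁺-n) (every order) from the non-containing cores of the slot table.** [this work] -/
theorem forall_masterFamilyCombPos_of_slot_noncontaining
    (hcore : ∀ (d n : ℕ), (∀ k, 1 ≤ k → k ≤ n + 1 → SlotPatternPos d k) →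
      ∀ W : Fin (n + 2) → Finset (Q d (n + 2)), (∀ j, IsUpperSet (W j : Set (Q d (n + 2)))) →
        (∀ j, ∃ y, (∀ k, k ≠ j → y ∈ W k) ∧ y ∉ W j) → 0 ≤ patternForm d (n + 2) (fun k => setInd (W k))) :
    ∀ n, MasterFamilyCombPos n :=
  fun n => masterFamilyCombPos_of_forall_slotPatternPos fun d => forall_slotPatternPos_of_noncontaining hcore d n

end Branching

end SahiSlot

end Summit.CriticalPhenomena.PercolationContinuityZ3.Theorems
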